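import Summits.BirchSwinnertonDyer.Rank1Residual.ManinAdditive.Psi32BrandtDegreeLawAtThirtyTwo
import Summits.BirchSwinnertonDyer.BirchSwinnertonDyer.Theorems.ManinLocalTwoThreeKodairaMenuAtTwo
import Summits.BirchSwinnertonDyer.BirchSwinnertonDyer.Theorems.ManinLocalTwoThreeIstarTwoExact
import Summits.BirchSwinnertonDyer.Rank1Residual.GaloisImage.TameThreeKodairaShape
import HarnessLib

/-!
# `32 ∥ N ⟹ (v₂Δ_min, v₂c₄) ∈ {(6,4), (9,4), (12,6), (12,7)}` — Papadopoulos' Table IV row `f₂ = 5` WITH ITS `c₄` COLUMN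
# (route `ManinLocalTwoThree`, crux C2 `ManinOddAtFour` stmt-BirchSwinnertonDyer-22967; cell bsd-f2-manin, prover seat p3 gen 15 —
# ask T-desc-38b of desc g20 / typer g20: `discriminantValuationAtThirtyTwo_holds`)

desc g20's ψ-Brandt degree law at `32 ∥ N` (`…ManinAdditive/Psi32BrandtDegreeLawAtThirtyTwo.lean`, p719868) files the E-facing support
row E-desc-144 `Psi32Brandt.DiscriminantValuationAtThirtyTwo` as a PLAIN `def` (a table row in print, Papadopoulos 1993 Table IV, `p = 2`,
`f = 5`): for a globally minimal `W/ℚ` with `v₂(N_W) = 5`, `(v₂Δ, v₂c₄) ∈ {(6,4), (9,4), (12,6), (12,7)}`.  Its `c₄` column is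
LOAD-BEARING there (it separates `I₃*/12` from `III*/12` in `brandtExponentAtThirtyTwo`).  The `Δ`-half is this seat's `f₂ = 5` type list
`kodairaSymbolAt_of_conductorExponent_eq_five_of_irreducible_two` (p3 g12: `III/6 · I₀*/9 · I₃*/12 · III*/12`); this file supplies the
`c₄` column from the tree's Tate normal forms at an absolutely unramified `2`-adic place and assembles the row:

* §1 (local, `2` a uniformiser, perfect residue field; pure Tate-algorithm bookkeeping):
  `addVal_c₄_toNat_eq_four_of_kodairaSymbolOfMinimal_eq_III_of_addVal_Δ_six` (`III`, `ord Δ = 6` ⟹ `ord c₄ = 4`: on the Step-4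
  model `[2α, a₂, 2γ, 2q, 4r₁]` the value `6` forces `α² + a₂ ∈ Rˣ`, and `c₄ = 2⁴((α² + a₂)² − 6q − 6αγ)`),
  `…_Istar_zero_of_addVal_Δ_nine` (`I₀*`, `9` ⟹ `4`: `α ∈ Rˣ`, `c₄ = 2⁴((α² + 2p)² − 12(q + αγ))`),
  `…_eq_six_…_Istar_three_of_addVal_Δ_twelve` (`I₃*`, `12` ⟹ `6`: the row `(3, 6, 12)` of p3 g12's exact `Iₙ*` table
  `IstarCharTwo.addVal_Δ_toNat_of_kodairaSymbolOfMinimal_eq_Istar_succ`), `…_eq_seven_…_IIIstar_of_addVal_Δ_twelve` (`III*`, `12` ⟹ `7`: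
  `[4α₁, 4p, 8γ, 8q, 32r]`, `q ∈ Rˣ`, `c₄ = 2⁷(2(α₁² + p)² − 3q − 6α₁γ)`).
* §2 (over `ℚ`, the place `v₂` of `𝓞 ℚ`): the bridges `ordMinimalDiscriminant_vTwo_eq_addVal_integralModelInt` and
  `padicValRat_two_c₄_eq_of_addVal_integralModelInt` (a globally minimal `W` is `𝓞_v`-minimal, so Tate's algorithm, `ord Δ_min` and
  `ord c₄` are read on `integralModelInt W ⊗ 𝓞_v`; for an integer `n`, `n ∈ 𝔪_vᵏ ⟺ 2ᵏ ∣ n`), the by-type theorem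
  `kodairaSymbolAt_vTwo_padicValRat_of_padicValNat_conductorNorm_eq_five` (**`32 ∥ N ⟹ III ∧ (6,4) ∨ I₀* ∧ (9,4) ∨ I₃* ∧ (12,6) ∨
  III* ∧ (12,7)`**);
* §3 **`discriminantValuationAtThirtyTwo_holds : Psi32Brandt.DiscriminantValuationAtThirtyTwo`** (E-desc-144 by name, in this file's namespace
  as `notTrivialEisensteinOfIrreducibleAtTwo_holds` was) and `brandtExponentAtThirtyTwo_by_type` (desc's `κ`: `1 ↔ III`, `3 ↔ III*`, `2 ↔ I₀* ∨ I₃*`).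

HONEST FRAMING.  Local bookkeeping from Tate's algorithm, in print (Papadopoulos 1993, Table IV), kernel-checked; nothing about C2, Manin's
conjecture or BSD is proved.  No definitions, no named facts, no sorry; axioms standard.

[cite: Papadopoulos1993, Table IV (p = 2): rows with f = 5 — (III, v(c₄)=4, v(Δ)=6), (I₀*, 4, 9), (I₃*, 6, 12), (III*, 7, 12)]
[cite: SilvermanATAEC1994, IV.9.4 Steps 4, 6, 7, 9 and Table 4.1 (PDF pp. 344–346, 365)] [cite: SilvermanAEC2009, III.1 (c₄ = b₂² − 24b₄), VII.1.3, VIII.8]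
-/

set_option autoImplicit false
-- lint-debt: the directory name repeats the summit name (sibling precedent `ManinLocalTwoThreeKodairaMenuAtTwo.lean`)
set_option linter.dupNamespace false

noncomputable section

open scoped Classical NumberField
open Polynomial IsLocalRing WeierstrassCurve
open IsDiscreteValuationRing hiding maximalIdeal
open Literature.NumberTheory.DiophantineGeometry Literature.NumberTheory.DiophantineGeometry.TateAlgorithm
  Literature.NumberTheory.DiophantineGeometry.TateAlgorithm.CharTwo Literature.NumberTheory.EllipticCurves

namespace Summit.BirchSwinnertonDyer.BirchSwinnertonDyer.Theorems.ManinLocalTwoThree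

/-! ## §1 The `c₄` column at `2` on the four `f₂ = 5` branches (`2` a uniformiser) -/

section TwoUniformizer

variable {R : Type*} [CommRing R] [IsDomain R] [IsDiscreteValuationRing R]

/-- `ord c₄` is unchanged by a change of variables over `R` (`c₄ ↦ u⁻⁴c₄`, `u ∈ Rˣ`); private copy of the sibling
`…PotOrdinaryShapeTwo`'s lemma of the same name (its import cone is not needed here). [cite: SilvermanAEC2009, III.1 Table 3.1] -/
private theorem addVal_c₄_toNat_smul (D : VariableChange R) (W : WeierstrassCurve R) :
    (addVal R (D • W).c₄).toNat = (addVal R W.c₄).toNat := by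
  rw [variableChange_c₄, addVal_mul, addVal_eq_zero_iff.mpr ((Units.isUnit D.u⁻¹).pow 4), zero_add]

/-- **Type `III` with `ord Δ = 6` has `ord c₄ = 4`** (`2` a uniformiser, perfect residue field).  On the Step-4 model `[2α, a₂, 2γ, 2q, 4r₁]`
(`q ∈ Rˣ`, `8 ∤ b₈`) of `exists_smul_of_kodairaSymbolOfMinimal_eq_III`, `ord Δ = 6` excludes the sub-branches `γ ∈ Rˣ` (`ord Δ = 4`) and
`2 ∣ α² + a₂` (`ord Δ ∈ {8, 9}`) of `addVal_Δ_toNat_of_step4`, so `α² + a₂ ∈ Rˣ`; and `c₄ = b₂² − 24b₄ = 2⁴((α² + a₂)² − 6q − 6αγ)`.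
[cite: Papadopoulos1993, Table IV (p = 2), row (III, v(c₄) = 4, v(Δ) = 6)] [cite: SilvermanATAEC1994, IV.9.4 Step 4] -/
theorem addVal_c₄_toNat_eq_four_of_kodairaSymbolOfMinimal_eq_III_of_addVal_Δ_six [PerfectField (ResidueField R)]
    (h2 : Irreducible (2 : R)) (V : WeierstrassCurve R) (hV : V.kodairaSymbolOfMinimal = .III) (hΔ : (addVal R V.Δ).toNat = 6) :
    (addVal R V.c₄).toNat = 4 := by
  obtain ⟨D, h₁, h₂, h₃, h₄, h₄', h₆⟩ := LocalIndex.exists_smul_of_kodairaSymbolOfMinimal_eq_III V hV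
  have hm : ∀ {x : R}, x ∈ maximalIdeal R ↔ (2 : R) ∣ x := fun {x} ↦ mem_maximalIdeal_iff_dvd_of_irreducible h2 x
  have hmn : ∀ {x : R} {n : ℕ}, x ∈ maximalIdeal R ^ n ↔ (2 : R) ^ n ∣ x := fun {x n} ↦
    mem_maximalIdeal_pow_iff_dvd_of_irreducible h2 x n
  set N := D • V with hN
  obtain ⟨α, hα⟩ := hm.mp h₁
  obtain ⟨p, hp⟩ := hm.mp h₂
  obtain ⟨γ, hγ⟩ := hm.mp h₃
  obtain ⟨q, hq⟩ := hm.mp h₄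
  obtain ⟨r₁, hr₁⟩ := hmn.mp h₆
  have hqu : IsUnit q := by
    rw [isUnit_iff_not_dvd h2]
    rintro ⟨q', hq'⟩
    exact h₄' (hmn.mpr ⟨q', by rw [hq, hq']; ring⟩)
  have h8 : ¬ (2 : R) ^ 3 ∣ N.b₈ := by
    rintro ⟨w, hw⟩
    have hb₈ : N.b₈ = 2 ^ 2 * (-q ^ 2 + 2 * (2 * α ^ 2 * r₁ + 4 * p * r₁ - α * γ * q + p * γ ^ 2)) := by
      simp only [WeierstrassCurve.b₈, hα, hp, hγ, hq, hr₁]; ring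
    have hq2 : (2 : R) ∣ q ^ 2 := ⟨-(w - (2 * α ^ 2 * r₁ + 4 * p * r₁ - α * γ * q + p * γ ^ 2)), by
      have e : (2 : R) ^ 2 * (-q ^ 2 + 2 * (2 * α ^ 2 * r₁ + 4 * p * r₁ - α * γ * q + p * γ ^ 2)) = 2 ^ 3 * w := by
        rw [← hb₈, hw]
      have e' : -q ^ 2 + 2 * (2 * α ^ 2 * r₁ + 4 * p * r₁ - α * γ * q + p * γ ^ 2) = 2 * w :=
        mul_left_cancel₀ (pow_ne_zero 2 h2.ne_zero) (by linear_combination e)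
      linear_combination -e'⟩
    exact (isUnit_iff_not_dvd h2 _).mp hqu (h2.prime.dvd_of_dvd_pow hq2)
  have hΔN : (addVal R N.Δ).toNat = 6 := by rw [hN, addVal_Δ_smul_toNat]; exact hΔ
  obtain ⟨h4, -, -, h8', h9⟩ := addVal_Δ_toNat_of_step4 h2 N hα hγ hq hr₁ h8
  have hγu : ¬ IsUnit γ := fun hγu ↦ by have := h4 hγu; omega
  obtain ⟨γ₁, hγ₁⟩ := (not_isUnit_iff_dvd h2 _).mp hγu
  have hB : IsUnit (α ^ 2 + N.a₂) := by
    by_contra hB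
    obtain ⟨β, hβ⟩ := (not_isUnit_iff_dvd h2 _).mp hB
    have ha₂ : N.a₂ = 2 * β - α ^ 2 := by linear_combination hβ
    by_cases hT : IsUnit (β * q + γ₁ ^ 2 + r₁)
    · have := h8' γ₁ β hγ₁ ha₂ hT; omega
    · have := h9 γ₁ β hγ₁ ha₂ hT; omega
  have e : N.c₄ = 2 ^ 4 * ((α ^ 2 + N.a₂) ^ 2 + 2 * (-(3 * q) - 3 * α * γ)) := by
    simp only [WeierstrassCurve.c₄, WeierstrassCurve.b₂, WeierstrassCurve.b₄, hα, hγ, hq]; ring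
  rw [← addVal_c₄_toNat_smul D V]
  exact addVal_toNat_eq_of_two h2 (hB.pow 2) e

/-- **Type `I₀*` with `ord Δ = 9` has `ord c₄ = 4`** (`2` a uniformiser, perfect residue field).  On the Step-6 model `[2α, 2p, 4γ, 4q, 8r]`
(`pq + r ∈ Rˣ`) of `exists_smul_of_kodairaSymbolOfMinimal_eq_Istar_zero`, `ord Δ = 9` is the sub-branch `2 ∣ α²q + γ²`, `α ∈ Rˣ` of
`addVal_Δ_toNat_of_step6`; and `c₄ = 2⁴((α² + 2p)² − 12(q + αγ)) = 2⁴(α⁴ + 2·…)`.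
[cite: Papadopoulos1993, Table IV (p = 2), row (I₀*, v(c₄) = 4, v(Δ) = 9)] [cite: SilvermanATAEC1994, IV.9.4 Step 6] -/
theorem addVal_c₄_toNat_eq_four_of_kodairaSymbolOfMinimal_eq_Istar_zero_of_addVal_Δ_nine [PerfectField (ResidueField R)]
    (h2 : Irreducible (2 : R)) (V : WeierstrassCurve R) (hΔ0 : V.Δ ≠ 0) (hV : V.kodairaSymbolOfMinimal = .Istar 0)
    (hΔ : (addVal R V.Δ).toNat = 9) : (addVal R V.c₄).toNat = 4 := by
  obtain ⟨D, h₁, h₂, h₃, h₄, h₆, h3⟩ := LocalIndex.exists_smul_of_kodairaSymbolOfMinimal_eq_Istar_zero V hΔ0 hV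
  have hm : ∀ {x : R}, x ∈ maximalIdeal R ↔ (2 : R) ∣ x := fun {x} ↦ mem_maximalIdeal_iff_dvd_of_irreducible h2 x
  have hmn : ∀ {x : R} {n : ℕ}, x ∈ maximalIdeal R ^ n ↔ (2 : R) ^ n ∣ x := fun {x n} ↦
    mem_maximalIdeal_pow_iff_dvd_of_irreducible h2 x n
  set N := D • V with hN
  obtain ⟨α, hα⟩ := hm.mp h₁
  obtain ⟨p, hp⟩ := hm.mp h₂
  obtain ⟨γ, hγ⟩ := hmn.mp h₃
  obtain ⟨q, hq⟩ := hmn.mp h₄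
  obtain ⟨r, hr⟩ := hmn.mp h₆
  have hI := isUnit_of_distinctRootCount_cubicStep6_eq_three h2 hp hq hr h3
  have hΔN : (addVal R N.Δ).toNat = 9 := by rw [hN, addVal_Δ_smul_toNat]; exact hΔ
  obtain ⟨h8, -, h10⟩ := addVal_Δ_toNat_of_step6 h2 N hα hp hγ hq hr hI
  have hT : ¬ IsUnit (α ^ 2 * q + γ ^ 2) := fun hT ↦ by have := h8 hT; omega
  have hαu : IsUnit α := by
    by_contra hαu
    have := h10 hT hαu; omega
  have e : N.c₄ = 2 ^ 4 * (α ^ 4 + 2 * (2 * α ^ 2 * p + 2 * p ^ 2 - 6 * q - 6 * α * γ)) := by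
    simp only [WeierstrassCurve.c₄, WeierstrassCurve.b₂, WeierstrassCurve.b₄, hα, hp, hγ, hq]; ring
  rw [← addVal_c₄_toNat_smul D V]
  exact addVal_toNat_eq_of_two h2 (hαu.pow 4) e

/-- **Type `I₃*` with `ord Δ = 12` has `ord c₄ = 6`** (`2` a uniformiser, perfect residue field): the row `(n, ord c₄, ord Δ) = (3, 6, 12)` of
p3 g12's exact `Iₙ*` table `IstarCharTwo.addVal_Δ_toNat_of_kodairaSymbolOfMinimal_eq_Istar_succ` (`I₃*`: `(4, 11)` or `(6, 12)`).
[cite: Papadopoulos1993, Table IV (p = 2), row (I₃*, v(c₄) = 6, v(Δ) = 12)] [cite: SilvermanATAEC1994, IV.9.4 Step 7] -/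
theorem addVal_c₄_toNat_eq_six_of_kodairaSymbolOfMinimal_eq_Istar_three_of_addVal_Δ_twelve [PerfectField (ResidueField R)]
    (h2 : Irreducible (2 : R)) (V : WeierstrassCurve R) (hΔ0 : V.Δ ≠ 0) (hV : V.kodairaSymbolOfMinimal = .Istar 3)
    (hΔ : (addVal R V.Δ).toNat = 12) : (addVal R V.c₄).toNat = 6 := by
  rcases IstarCharTwo.addVal_Δ_toNat_of_kodairaSymbolOfMinimal_eq_Istar_succ h2 V hΔ0 (n := 2) hV with ⟨h4, hΔ'⟩ | ⟨h6, -⟩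
  · exfalso; omega
  · exact h6

/-- **Type `III*` with `ord Δ = 12` has `ord c₄ = 7`** (`2` a uniformiser, perfect residue field).  On the Step-9 model `[2α, 4p, 8γ, 8q, 32r]`
(`q ∈ Rˣ`) of `exists_smul_of_kodairaSymbolOfMinimal_eq_IIIstar`, `ord Δ = 10` if `α ∈ Rˣ` (`addVal_Δ_toNat_of_step9`), so `ord Δ = 12` forces
`α = 2α₁`, and `c₄ = 2⁷(2(α₁² + p)² − 3q − 6α₁γ) = 2⁷(q + 2·…)`.
[cite: Papadopoulos1993, Table IV (p = 2), row (III*, v(c₄) = 7, v(Δ) = 12)] [cite: SilvermanATAEC1994, IV.9.4 Step 9] -/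
theorem addVal_c₄_toNat_eq_seven_of_kodairaSymbolOfMinimal_eq_IIIstar_of_addVal_Δ_twelve [PerfectField (ResidueField R)]
    (h2 : Irreducible (2 : R)) (V : WeierstrassCurve R) (hV : V.kodairaSymbolOfMinimal = .IIIstar) (hΔ : (addVal R V.Δ).toNat = 12) :
    (addVal R V.c₄).toNat = 7 := by
  obtain ⟨D, h₁, h₂, h₃, h₄, h₄', h₆⟩ := LocalIndex.exists_smul_of_kodairaSymbolOfMinimal_eq_IIIstar V hV
  have hm : ∀ {x : R}, x ∈ maximalIdeal R ↔ (2 : R) ∣ x := fun {x} ↦ mem_maximalIdeal_iff_dvd_of_irreducible h2 x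
  have hmn : ∀ {x : R} {n : ℕ}, x ∈ maximalIdeal R ^ n ↔ (2 : R) ^ n ∣ x := fun {x n} ↦
    mem_maximalIdeal_pow_iff_dvd_of_irreducible h2 x n
  set N := D • V with hN
  obtain ⟨α, hα⟩ := hm.mp h₁
  obtain ⟨p, hp⟩ := hmn.mp h₂
  obtain ⟨γ, hγ⟩ := hmn.mp h₃
  obtain ⟨q, hq⟩ := hmn.mp h₄
  obtain ⟨r, hr⟩ := hmn.mp h₆
  have hqu : IsUnit q := by
    rw [isUnit_iff_not_dvd h2]
    rintro ⟨q', hq'⟩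
    exact h₄' (hmn.mpr ⟨q', by rw [hq, hq']; ring⟩)
  have hΔN : (addVal R N.Δ).toNat = 12 := by rw [hN, addVal_Δ_smul_toNat]; exact hΔ
  obtain ⟨h10, -, -, -⟩ := addVal_Δ_toNat_of_step9 h2 N hα hp hγ hq hr hqu
  have hαu : ¬ IsUnit α := fun hαu ↦ by have := h10 hαu; omega
  obtain ⟨α₁, hα₁⟩ := (not_isUnit_iff_dvd h2 _).mp hαu
  have e : N.c₄ = 2 ^ 7 * (q + 2 * ((α₁ ^ 2 + p) ^ 2 - 3 * α₁ * γ - 2 * q)) := by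
    simp only [WeierstrassCurve.c₄, WeierstrassCurve.b₂, WeierstrassCurve.b₄, hα, hp, hγ, hq, hα₁]; ring
  rw [← addVal_c₄_toNat_smul D V]
  exact addVal_toNat_eq_of_two h2 hqu e

end TwoUniformizer

/-! ## §2 Over `ℚ`: the place `v₂` of `𝓞 ℚ`, the bridges to `integralModelInt W`, and row E-desc-144 -/

section Rat

open IsDedekindDomain IsDedekindDomain.HeightOneSpectrum Rat.HeightOneSpectrum NumberField
  Summit.BirchSwinnertonDyer.Rank1Residual.GaloisImage Summit.BirchSwinnertonDyer.Rank1Residual.ManinAdditive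

/-- **For an integer `n` at a place `v ∣ p` of `𝓞 ℚ`: `ord_v n = k ≠ 0` in `𝓞_v` gives `v_p(n) = k`** (`n ∈ 𝔪_vᵐ ⟺ pᵐ ∣ n`,
`intCast_mem_maximalIdeal_adicCompletionIntegers_pow_iff`). [folklore] -/
theorem padicValInt_eq_of_addVal_intCast_toNat (v : HeightOneSpectrum (𝓞 ℚ)) {p : ℕ} (hv : natGenerator v = p) (n : ℤ) {k : ℕ}
    (hk : k ≠ 0) (h : (addVal (v.adicCompletionIntegers ℚ) (n : v.adicCompletionIntegers ℚ)).toNat = k) :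
    padicValInt p n = k := by
  haveI : Fact p.Prime := ⟨hv ▸ prime_natGenerator v⟩
  have hirr : Irreducible ((p : ℕ) : v.adicCompletionIntegers ℚ) := hv ▸ irreducible_natGenerator_adicCompletionIntegers v
  have hne : addVal (v.adicCompletionIntegers ℚ) (n : v.adicCompletionIntegers ℚ) ≠ ⊤ := by
    intro htop
    rw [htop, ENat.toNat_top] at h
    exact hk h.symm
  have hval : addVal (v.adicCompletionIntegers ℚ) (n : v.adicCompletionIntegers ℚ) = k := by
    rw [← ENat.coe_toNat hne, h]
  have hdvd : ∀ m : ℕ, (p : ℤ) ^ m ∣ n ↔ m ≤ k := fun m ↦ by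
    rw [← hv, ← intCast_mem_maximalIdeal_adicCompletionIntegers_pow_iff v n m, mem_maximalIdeal_pow_iff_dvd_of_irreducible hirr,
      pow_dvd_iff_le_addVal_of_irreducible hirr, hval, Nat.cast_le]
  have hn0 : n ≠ 0 := by
    intro h0
    have := (hdvd (k + 1)).mp (by rw [h0]; exact dvd_zero _)
    omega
  have hle : k ≤ padicValInt p n := ((padicValInt_dvd_iff k n).mp ((hdvd k).mpr le_rfl)).resolve_left hn0
  have hlt : ¬ k + 1 ≤ padicValInt p n := fun hle' ↦ by
    have := (hdvd (k + 1)).mp ((padicValInt_dvd_iff (k + 1) n).mpr (Or.inr hle'))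
    omega
  omega

/-- **`ord_v(Δ_min)` is read on `integralModelInt W ⊗ 𝓞_v`** for a globally minimal `W` (`W ⊗ ℚ_v` is `𝓞_v`-minimal, `IsGloballyMinimal.isMinimal`;
`ordMinimalDiscriminant_eq_of_isMinimal`; Mathlib's integral model of `W ⊗ ℚ_v` is `integralModelInt W ⊗ 𝓞_v` because `𝓞_v → ℚ_v` is
injective).  Silverman *AEC* VII.1.3(b), VIII.8. [cite: SilvermanAEC2009, VII.1 Prop. 1.3(b) and VIII.8] -/
theorem ordMinimalDiscriminant_eq_addVal_integralModelInt (v : HeightOneSpectrum (𝓞 ℚ)) (W : WeierstrassCurve ℚ) [W.IsElliptic]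
    [W.IsGloballyMinimal] :
    W.ordMinimalDiscriminant v =
      (addVal (v.adicCompletionIntegers ℚ) ((integralModelInt W).map (Int.castRingHom (v.adicCompletionIntegers ℚ))).Δ).toNat := by
  haveI hmin : (W.baseChange (v.adicCompletion ℚ)).IsMinimal (v.adicCompletionIntegers ℚ) := IsGloballyMinimal.isMinimal (W := W) v
  have hΔ : (W.baseChange (v.adicCompletion ℚ)).Δ ≠ 0 := by
    rw [baseChange, map_Δ]
    exact (map_ne_zero_iff _ (algebraMap ℚ (v.adicCompletion ℚ)).injective).mpr W.isUnit_Δ.ne_zero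
  have hXI : (W.baseChange (v.adicCompletion ℚ)).integralModel (v.adicCompletionIntegers ℚ) =
      (integralModelInt W).map (Int.castRingHom (v.adicCompletionIntegers ℚ)) := by
    apply map_injective (IsFractionRing.injective (v.adicCompletionIntegers ℚ) (v.adicCompletion ℚ))
    change ((W.baseChange (v.adicCompletion ℚ)).integralModel (v.adicCompletionIntegers ℚ)).baseChange (v.adicCompletion ℚ) = _
    rw [baseChange_integralModel_eq]
    exact baseChange_eq_map_integralModelInt v W
  rw [ordMinimalDiscriminant_eq_of_isMinimal v W (W.baseChange (v.adicCompletion ℚ)) 1 (one_smul _ _).symm hΔ, hXI]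

/-- **`f_{v₂} = v₂(N_E)`** at the place of `𝓞 ℚ` over `2` (`N_E = ∏ p ^ f_p`, `factorization_conductorNorm_holds`; the exponent at the place of `𝓞 ℚ` is the
one at the place of `ℤ`, `conductorExponent_eq_of_primesEquiv_eq`). [cite: SilvermanAEC2009, C.16 (definition of the conductor)] -/
theorem conductorExponent_vTwo_eq_padicValNat_conductorNorm (W : WeierstrassCurve ℚ) [W.IsElliptic] :
    W.conductorExponent ((primesEquiv (R := 𝓞 ℚ)).symm ⟨2, Nat.prime_two⟩) = padicValNat 2 (W.conductorNorm ℤ) := by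
  have h1 := factorization_conductorNorm_holds W ((primesEquiv (R := ℤ)).symm ⟨2, Nat.prime_two⟩)
  rw [show natGenerator ((primesEquiv (R := ℤ)).symm ⟨2, Nat.prime_two⟩) = 2 from
    congrArg Subtype.val ((primesEquiv (R := ℤ)).apply_symm_apply ⟨2, Nat.prime_two⟩), Nat.factorization_def _ Nat.prime_two] at h1
  rw [← WeierstrassCurve.conductorExponent_eq_of_primesEquiv_eq ((primesEquiv (R := ℤ)).symm ⟨2, Nat.prime_two⟩)
    ((primesEquiv (R := 𝓞 ℚ)).symm ⟨2, Nat.prime_two⟩) W (by simp)]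
  exact h1.symm

/-- **`32 ∥ N_E`, by type, at the place of `𝓞 ℚ` over `2`, on a globally minimal model: `III ∧ (v₂Δ, v₂c₄) = (6,4)`, or `I₀* ∧ (9,4)`, or
`I₃* ∧ (12,6)`, or `III* ∧ (12,7)`** — Papadopoulos' Table IV row `f = 5` with its `c₄` column (the type list is p3 g12's
`kodairaSymbolAt_of_conductorExponent_eq_five_of_irreducible_two`; the `c₄` values are §1 read on `integralModelInt W ⊗ 𝓞_{v₂}`).
[cite: Papadopoulos1993, Table IV (p = 2), rows with f = 5] [cite: SilvermanATAEC1994, IV.9.4 Steps 4, 6, 7, 9 and Table 4.1] -/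
theorem kodairaSymbolAt_vTwo_padicValRat_of_padicValNat_conductorNorm_eq_five (W : WeierstrassCurve ℚ) [W.IsElliptic] [W.IsGloballyMinimal]
    (h5 : padicValNat 2 (W.conductorNorm ℤ) = 5) :
    (W.kodairaSymbolAt ((primesEquiv (R := 𝓞 ℚ)).symm ⟨2, Nat.prime_two⟩) = .III ∧ padicValRat 2 W.Δ = 6 ∧ padicValRat 2 W.c₄ = 4) ∨
    (W.kodairaSymbolAt ((primesEquiv (R := 𝓞 ℚ)).symm ⟨2, Nat.prime_two⟩) = .Istar 0 ∧ padicValRat 2 W.Δ = 9 ∧ padicValRat 2 W.c₄ = 4) ∨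
    (W.kodairaSymbolAt ((primesEquiv (R := 𝓞 ℚ)).symm ⟨2, Nat.prime_two⟩) = .Istar 3 ∧ padicValRat 2 W.Δ = 12 ∧ padicValRat 2 W.c₄ = 6) ∨
    (W.kodairaSymbolAt ((primesEquiv (R := 𝓞 ℚ)).symm ⟨2, Nat.prime_two⟩) = .IIIstar ∧ padicValRat 2 W.Δ = 12 ∧
      padicValRat 2 W.c₄ = 7) := by
  set v : HeightOneSpectrum (𝓞 ℚ) := (primesEquiv (R := 𝓞 ℚ)).symm ⟨2, Nat.prime_two⟩ with hvdef
  have hv : natGenerator v = 2 := congrArg Subtype.val ((primesEquiv (R := 𝓞 ℚ)).apply_symm_apply ⟨2, Nat.prime_two⟩)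
  haveI := WeierstrassCurve.perfectField_residueField_adicCompletionIntegers (K := ℚ) v
  have h2irr : Irreducible (2 : v.adicCompletionIntegers ℚ) := by
    have h := irreducible_natGenerator_adicCompletionIntegers v
    rwa [hv, Nat.cast_ofNat] at h
  have hf : W.conductorExponent v = 5 := by rw [hvdef, conductorExponent_vTwo_eq_padicValNat_conductorNorm, h5]
  set I := (integralModelInt W).map (Int.castRingHom (v.adicCompletionIntegers ℚ)) with hI
  have hK : W.kodairaSymbolAt v = I.kodairaSymbolOfMinimal := kodairaSymbolAt_eq_kodairaSymbolOfMinimal_integralModelInt v W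
  have hord : W.ordMinimalDiscriminant v = (addVal _ I.Δ).toNat := ordMinimalDiscriminant_eq_addVal_integralModelInt v W
  have hIΔ : I.Δ = ((minimalDiscriminantInt W : ℤ) : v.adicCompletionIntegers ℚ) := by
    rw [hI, map_Δ, eq_intCast]; rfl
  have hIc₄ : I.c₄ = (((integralModelInt W).c₄ : ℤ) : v.adicCompletionIntegers ℚ) := by rw [hI, map_c₄, eq_intCast]
  have hc₄Q : W.c₄ = (((integralModelInt W).c₄ : ℤ) : ℚ) := by
    have h := (integralModelInt W).map_c₄ (Int.castRingHom ℚ)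
    rw [map_integralModelInt, eq_intCast] at h
    exact h
  have tΔ : ∀ {k : ℕ}, k ≠ 0 → (addVal _ I.Δ).toNat = k → padicValRat 2 W.Δ = k := fun {k} hk h ↦ by
    rw [← cast_minimalDiscriminantInt W, padicValRat.of_int,
      padicValInt_eq_of_addVal_intCast_toNat v hv (minimalDiscriminantInt W) hk (by rw [← hIΔ]; exact h)]
  have tc₄ : ∀ {k : ℕ}, k ≠ 0 → (addVal _ I.c₄).toNat = k → padicValRat 2 W.c₄ = k := fun {k} hk h ↦ by
    rw [hc₄Q, padicValRat.of_int, padicValInt_eq_of_addVal_intCast_toNat v hv _ hk (by rw [← hIc₄]; exact h)]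
  rcases kodairaSymbolAt_of_conductorExponent_eq_five_of_irreducible_two v W h2irr hf with ⟨hT, ho⟩ | ⟨hT, ho⟩ | ⟨hT, ho⟩ | ⟨hT, ho⟩ <;>
    rw [hord] at ho <;> rw [hK] at hT
  · have hc := addVal_c₄_toNat_eq_four_of_kodairaSymbolOfMinimal_eq_III_of_addVal_Δ_six h2irr I hT ho
    exact Or.inl ⟨hK.trans hT, by exact_mod_cast tΔ (by norm_num) ho, by exact_mod_cast tc₄ (by norm_num) hc⟩
  · have hΔ0 : I.Δ ≠ 0 := fun h0 ↦ by rw [h0, addVal_zero, ENat.toNat_top] at ho; exact absurd ho (by norm_num)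
    have hc := addVal_c₄_toNat_eq_four_of_kodairaSymbolOfMinimal_eq_Istar_zero_of_addVal_Δ_nine h2irr I hΔ0 hT ho
    exact Or.inr (Or.inl ⟨hK.trans hT, by exact_mod_cast tΔ (by norm_num) ho, by exact_mod_cast tc₄ (by norm_num) hc⟩)
  · have hΔ0 : I.Δ ≠ 0 := fun h0 ↦ by rw [h0, addVal_zero, ENat.toNat_top] at ho; exact absurd ho (by norm_num)
    have hc := addVal_c₄_toNat_eq_six_of_kodairaSymbolOfMinimal_eq_Istar_three_of_addVal_Δ_twelve h2irr I hΔ0 hT ho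
    exact Or.inr (Or.inr (Or.inl ⟨hK.trans hT, by exact_mod_cast tΔ (by norm_num) ho, by exact_mod_cast tc₄ (by norm_num) hc⟩))
  · have hc := addVal_c₄_toNat_eq_seven_of_kodairaSymbolOfMinimal_eq_IIIstar_of_addVal_Δ_twelve h2irr I hT ho
    exact Or.inr (Or.inr (Or.inr ⟨hK.trans hT, by exact_mod_cast tΔ (by norm_num) ho, by exact_mod_cast tc₄ (by norm_num) hc⟩))

/-- `32 ∥ N` in divisibility form is `v₂(N) = 5`. [folklore] -/
theorem padicValNat_conductorNorm_eq_five_of_dvd (W : WeierstrassCurve ℚ) [W.IsElliptic]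
    (h32 : 2 ^ 5 ∣ W.conductorNorm ℤ) (h64 : ¬ 2 ^ 6 ∣ W.conductorNorm ℤ) : padicValNat 2 (W.conductorNorm ℤ) = 5 := by
  have hN : W.conductorNorm ℤ ≠ 0 := (conductorNorm_pos_holds W).ne'
  rw [padicValNat_dvd_iff_le hN] at h32 h64
  omega

/-- **`32 ∥ N ⟹ (v₂Δ, v₂c₄) ∈ {(6,4), (9,4), (12,6), (12,7)}` on a globally minimal model** — desc's currency (E-desc-144 unfolded).
[cite: Papadopoulos1993, Table IV (p = 2), rows with f = 5] -/
theorem padicValRat_two_Δ_c₄_of_padicValNat_conductorNorm_eq_five (W : WeierstrassCurve ℚ) [W.IsElliptic] [W.IsGloballyMinimal]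
    (h5 : padicValNat 2 (W.conductorNorm ℤ) = 5) :
    (padicValRat 2 W.Δ = 6 ∧ padicValRat 2 W.c₄ = 4) ∨ (padicValRat 2 W.Δ = 9 ∧ padicValRat 2 W.c₄ = 4) ∨
      (padicValRat 2 W.Δ = 12 ∧ padicValRat 2 W.c₄ = 6) ∨ (padicValRat 2 W.Δ = 12 ∧ padicValRat 2 W.c₄ = 7) := by
  rcases kodairaSymbolAt_vTwo_padicValRat_of_padicValNat_conductorNorm_eq_five W h5 with ⟨-, h⟩ | ⟨-, h⟩ | ⟨-, h⟩ | ⟨-, h⟩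
  · exact Or.inl h
  · exact Or.inr (Or.inl h)
  · exact Or.inr (Or.inr (Or.inl h))
  · exact Or.inr (Or.inr (Or.inr h))

/-! ## §3 Row E-desc-144 by name, and desc's Brandt exponent reads the Kodaira type faithfully -/

/-- **Row E-desc-144 `Psi32Brandt.DiscriminantValuationAtThirtyTwo` HOLDS** (Papadopoulos' Table IV row `f₂ = 5` with its `c₄` column,
kernel-checked from Tate's algorithm at `2`: `padicValRat_two_Δ_c₄_of_padicValNat_conductorNorm_eq_five`).  Ask T-desc-38b (desc g20 / typer g20).
Nothing about the ψ-Brandt degree law E-desc-141, C2, Manin's conjecture or BSD is proved by this. [cite: Papadopoulos1993, Table IV (p = 2), rows with f = 5] -/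
theorem discriminantValuationAtThirtyTwo_holds : Psi32Brandt.DiscriminantValuationAtThirtyTwo :=
  fun W _ _ h5 ↦ padicValRat_two_Δ_c₄_of_padicValNat_conductorNorm_eq_five W h5

/-- **desc's Brandt exponent `κ` at `32 ∥ N` reads the Kodaira type at `2` faithfully** (on a globally minimal model): `κ = 1 ↔ III`,
`κ = 3 ↔ III*`, and otherwise (`I₀*`, `I₃*`) `κ = 2` — the `c₄` column is what separates `I₃*/12` (`v₂c₄ = 6`) from `III*/12` (`v₂c₄ = 7`).
[cite: Papadopoulos1993, Table IV (p = 2), rows with f = 5] -/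
theorem brandtExponentAtThirtyTwo_by_type (W : WeierstrassCurve ℚ) [W.IsElliptic] [W.IsGloballyMinimal]
    (h5 : padicValNat 2 (W.conductorNorm ℤ) = 5) :
    (Psi32Brandt.brandtExponentAtThirtyTwo W = 1 ↔ W.kodairaSymbolAt ((primesEquiv (R := 𝓞 ℚ)).symm ⟨2, Nat.prime_two⟩) = .III) ∧
    (Psi32Brandt.brandtExponentAtThirtyTwo W = 3 ↔ W.kodairaSymbolAt ((primesEquiv (R := 𝓞 ℚ)).symm ⟨2, Nat.prime_two⟩) = .IIIstar) ∧
    (Psi32Brandt.brandtExponentAtThirtyTwo W = 2 ↔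
      (W.kodairaSymbolAt ((primesEquiv (R := 𝓞 ℚ)).symm ⟨2, Nat.prime_two⟩) = .Istar 0 ∨
        W.kodairaSymbolAt ((primesEquiv (R := 𝓞 ℚ)).symm ⟨2, Nat.prime_two⟩) = .Istar 3)) := by
  unfold Psi32Brandt.brandtExponentAtThirtyTwo
  rcases kodairaSymbolAt_vTwo_padicValRat_of_padicValNat_conductorNorm_eq_five W h5 with
      ⟨hT, hΔ, hc⟩ | ⟨hT, hΔ, hc⟩ | ⟨hT, hΔ, hc⟩ | ⟨hT, hΔ, hc⟩ <;>
    simp [hT, hΔ, hc]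

end Rat

end Summit.BirchSwinnertonDyer.BirchSwinnertonDyer.Theorems.ManinLocalTwoThree

end
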